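import Summits.BirchSwinnertonDyer.BirchSwinnertonDyer.Theorems.UniversalToricDescentSurjLeafOfInclusionAndEisenstein
import Summits.BirchSwinnertonDyer.BirchSwinnertonDyer.Theorems.RankLeOneBSDpOfUpperSocketCertificate
import Summits.BirchSwinnertonDyer.BirchSwinnertonDyer.Theorems.AdditiveRankOneBSDpRowKernels
import HarnessLib

/-!
# UTD's wall crux `AdditiveSplitIMCInclusionAtThree` (stmt-BirchSwinnertonDyer-20395) in CERTIFICATE currency:
# the inclusion `(L) ⊆ Ch_Λ(X_(∅,0))·R₀⟦T⟧` at ONE Heegner datum + ports + FINITE certificates ⟹ `BSD₃(E)` AND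
# `BSD₃(E^{d_K})` on the onto wild rank-one rows — NO twin, NO Kolyvagin system, NO tower, NO rank-zero leaf;
# and the same in the ♭-receptacle at ANY odd additive prime from the displayed ♭-inclusion + Hsieh + LZZ
# (cell `bsd-wall`, D-0131 (3) M-UTD, seat `bsd-wall-utd-p3` gen 2)

Composition of gen 2's two files: `UniversalToricDescentSurjLeafOfInclusionAndEisenstein.lean` (p555777, §1
`indexUpperBoundLeAt_of_additiveSplitIMCInclusionAtThree`: 20395 + 20385 + 20386 + Kolyvagin ⟹ the upper index
socket at a datum, BY NAME over the UTD route file) and `RankLeOneBSDpOfUpperSocketCertificate.lean`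
(socket + certificates ⟹ `BSD_p`, route-free), plus kmc g20's ♭ producer
`UniversalToricDescentWaldspurgerFlat.indexUpperBoundLeAt_of_flatInclGe_of_control`
(`AdditiveRankOneBSDpRowKernels.lean`); socket file p556566.

* §1 (`p = 3`, BY NAME). For `W` on the cell (`ClassO6 W 3`, `ρ̄_{E,3}` onto, `r_an = 1`) and ONE Heegner
  datum `(K, Dt, H, ι, P)` for `N(E)` with `L(E^{d_K},1) ≠ 0`:
  `padicValNat_shaOrder_eq_zero_of_additiveSplitIMCInclusionAtThree_of_index_le` (index certificate
  `ord₃[E(K):ℤP] ≤ ord₃ ∏_ℓ c_ℓ(E) + v₃(c)` ⟹ `Ш(E/K)`, `Ш(E/ℚ)` `3`-free);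
  **`bsdp_three_of_additiveSplitIMCInclusionAtThree_of_index_le_of_shaAnUnit`** (+ `#Ш_an(E)` a `3`-adic
  unit ⟹ `BSDp W 3` — the JET-PRODUCT shape, NO leaf #6);
  **`partner_bsdp_three_of_additiveSplitIMCInclusionAtThree_of_index_le_of_shaAnUnit`** (`BSDp Wd 3` for any
  globally minimal model `Wd` of the rank-ZERO wild twist `E^{d_K}`, from `#Ш_an(Wd)` a unit);
  `bsdp_three_of_additiveSplitIMCInclusionAtThree_of_excess_certificates` /
  `partner_bsdp_three_of_additiveSplitIMCInclusionAtThree_of_excess_certificates` (index excess `e` + `3`-descent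
  lower certificates `a + b = 2e` — the TAM3FREE / INDEX-EXCESS / SHA3-AN shapes).
* §2 (any odd additive `p`, ♭-receptacle, displayed inclusion). For `W` additive at `p`, ONE Heegner datum with
  `d_K < −4`, `P` non-torsion, Kolyvagin for the datum, the ♭-inclusion `(Q) ⊆ Ch·𝓞_{ℂ_p}⟦T⟧` at every frame of
  this `K` and exact control at every degree-one `𝔭` (both displayed, as in kmc g20), Hsieh 2014 Thm A and LZZ
  2018 (named): `bsdp_of_flatInclGe_of_index_le_of_shaAnUnit` (`r_an(E) ≤ 1`) and
  `partner_bsdp_of_flatInclGe_of_excess_certificates`. No route item, no `R₀`.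

PARTITION currency (census `bsd-wall-census/blockA/BLOCK-A-index.md`, READ; onto-W `r_an = 1` residue at `3`:
3 894 classes, R758 3 893): §1 types EVERY row as {20395} + {20385 (= 20928 frame + LZZ), 20386 (closed modulo
seven cite-level facts)} + print + finite certificates: JET-PRODUCT **3 413** (`e = 0`; `Ш_an(E)` `3`-free by
definition of the row), TAM3FREE **289** / INDEX-EXCESS **183** (`e = i3 − t3 > 0`, `a = 0`, `b = 2e` by a
`3`-descent on `E^{d_K}` — census g11: `e = ½·ord₃ #Ш_an(E^D)` on all of them), SHA3-AN **9** (`a = 2`). The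
rank-ZERO wild twists of these rows (leaf #6's habitat ∩ Heegner twists) are paid by the same input (partner
theorems). §2 does the same in ♭ with NO open port (Hsieh + LZZ refereed) for ANY odd additive `p`.
Compare gen 1 (p546379/p548538): identical certificate theorems from SOED's J 20760 + Matar–Nekovář; the two
novel routes' accounting now agree: ONE research statement at `E` (an inclusion, or a divisibility) per row.
Classes closed: 0. «beyond-print theorem»: NO. HONEST FRAMING: CONDITIONAL on 20395 (research-grade), on the
named port items / facts and on the certificates; per datum; books nothing by itself; BSD is proved for no
curve by this file. No definition, no named fact, no `sorry`.
References: [JetchevSkinnerWan2017] §7.4.1 (arXiv:1512.06894 p. 30); [Castella2018] Thm. 2.3, §5;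
[Hsieh2014] Thm. A; [LiuZhangZhang2018] Thm 1.5.1/1.5.3; [Jetchev2008] Cor. 1.5 and (1); [Miller2011LMS]
Def. 1.1; [DokchitserDokchitserAnnals2010] Lemma 4.14; [GrossZagier1986] Thm. I.(6.3).
-/

noncomputable section

open scoped Classical

set_option linter.dupNamespace false
set_option autoImplicit false

namespace Summit.BirchSwinnertonDyer.BirchSwinnertonDyer.Theorems.WildThreeInclusionKernel

open WeierstrassCurve NumberField IsDedekindDomain Field
  Literature.NumberTheory.EllipticCurves
  Literature.NumberTheory.EllipticCurves.ModularForms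
  Literature.NumberTheory.EllipticCurves.Rank1Residual
  Literature.NumberTheory.EllipticCurves.Rank1Residual.Typed
  Literature.NumberTheory.EllipticCurves.KrizLi2019
  Literature.NumberTheory.GaloisRepresentations
  Summit.BirchSwinnertonDyer.Rank1Residual
  Summit.BirchSwinnertonDyer.Rank1Residual.Additive
  Summit.BirchSwinnertonDyer.Rank1Residual.X11b
  Summit.BirchSwinnertonDyer.Rank1Residual.X11b.AcSelmer
  Summit.BirchSwinnertonDyer.Rank1Residual.X11b.Halves
  Summit.BirchSwinnertonDyer.BirchSwinnertonDyer.Theses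

/-! ### §1 `p = 3`, BY NAME over route `UniversalToricDescent` -/

section ByName

variable
  (hGZ : ∀ (N : ℕ) [NeZero N] (W : WeierstrassCurve ℚ) (K : Type) [Field K] [NumberField K],
    gross_zagier N W K)
  (hKo : ∀ (N : ℕ) [NeZero N] (W : WeierstrassCurve ℚ) (K : Type) [Field K] [NumberField K],
    kolyvagin N W K)
  (hmod : hasEntireLFunction_rat)
  (hI : UniversalToricDescent.AdditiveSplitIMCInclusionAtThree)
  (hV : UniversalToricDescent.WildSplitWaldspurgerAtThree)
  (hC : UniversalToricDescent.WildSplitControlAtThree)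
  (W : WeierstrassCurve ℚ) [W.IsElliptic] [W.IsGloballyMinimal] [NeZero (W.conductorNorm ℤ)]
  (hO6 : ClassO6 W 3) (hsurj : W.HasSurjectiveModNGaloisRep 3) (hr : W.analyticRank = 1)
  (K : Type) [Field K] [NumberField K]
  (Dt : ModularParametrizationData W (W.conductorNorm ℤ))
  (H : HeegnerDatum (W.conductorNorm ℤ) (NumberField.discr K)) (ι : K →+* ℂ)
  (P : (W.baseChange K).toAffine.Point)
  (hK : IsImaginaryQuadratic K) (hHH : SatisfiesHeegnerHypothesis (W.conductorNorm ℤ) K)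
  (hLd : (W.quadraticTwist (NumberField.discr K : ℚ)).entireLFunction 1 ≠ 0)
  (hP : WeierstrassCurve.Affine.Point.map ι.toRatAlgHom P = heegnerPointComplex Dt H)

omit [W.IsGloballyMinimal] in
include hGZ hmod hr hK hHH hLd hP in
/-- The Heegner point of a datum with `r_an(E) = 1` and `L(E^{d_K},1) ≠ 0` is non-torsion (Gross–Zagier;
bookkeeping shared by §1). [cite: GrossZagier1986, Thm. I.(6.3) and V.§2] -/
theorem not_isOfFinAddOrder_of_rankOne_datum : ¬ IsOfFinAddOrder P := by
  have hL0 : W.entireLFunction 1 = 0 := entireLFunction_one_eq_zero_of_analyticRank_eq_one hr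
  obtain ⟨-, hderiv⟩ := leadingLCoeff_eq_deriv_of_analyticRank_eq_one hr
  have hLK : LDerivEK W K ≠ 0 := by
    rw [lDerivEK_eq_deriv_mul W K hmod hL0]; exact mul_ne_zero hderiv hLd
  exact (lDerivEK_ne_zero_iff_not_isOfFinAddOrder W (W.conductorNorm ℤ) K (hGZ _ W K) hK hHH
    ⟨Dt, H, ι, hP⟩).mp hLK

include hGZ hKo hmod hI hV hC hO6 hsurj hr hK hHH hLd hP in
/-- **20395 + index certificate ⟹ `Ш(E/K)` and `Ш(E/ℚ)` are `3`-free.** Data: `W` on the cell, one Heegner datum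
with `L(E^{d_K},1) ≠ 0`, the certificate `ord₃ [E(K):ℤP] ≤ ord₃ ∏_ℓ c_ℓ(E) + v₃(c(Dt))`; inputs BY NAME:
Gross–Zagier, Kolyvagin, modularity (named facts), `AdditiveSplitIMCInclusionAtThree` (20395),
`WildSplitWaldspurgerAtThree` (20385), `WildSplitControlAtThree` (20386). CONDITIONAL; per datum.
[cite: Jetchev2008, Cor. 1.5 and (1) (p. 812)] [cite: JetchevSkinnerWan2017, §7.4.1 (arXiv:1512.06894 p. 30)] -/
theorem padicValNat_shaOrder_eq_zero_of_additiveSplitIMCInclusionAtThree_of_index_le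
    (hIdx : padicValNat 3 (AddSubgroup.zmultiples P).index ≤
      padicValNat 3 W.tamagawaProduct + padicValNat 3 Dt.c.natAbs) :
    padicValNat 3 (W.baseChange K).shaOrder = 0 ∧ padicValNat 3 W.shaOrder = 0 := by
  have hnt := not_isOfFinAddOrder_of_rankOne_datum hGZ hmod W hr K Dt H ι P hK hHH hLd hP
  exact SchneiderFree.Exact.padicValNat_shaOrder_eq_zero_of_upper_of_index_le W K hK 3 (by decide)
    (indexUpperBoundLeAt_of_additiveSplitIMCInclusionAtThree hKo hI hV hC W (W.conductorNorm ℤ) K Dt H ι P hO6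
      hsurj hr rfl hK hHH hLd hP hnt)
    hIdx (hKo (W.conductorNorm ℤ) W K hK hHH ⟨Dt, H, ι, hP⟩ hnt).2

include hGZ hKo hmod hI hV hC hO6 hsurj hr hK hHH hLd hP in
/-- **`BSD₃(E)` on the JET-PRODUCT shape from UTD's inclusion crux ALONE — NO rank-zero leaf, NO twin.** Data as in
`padicValNat_shaOrder_eq_zero_of_additiveSplitIMCInclusionAtThree_of_index_le` plus GZK (named) and the analytic
certificate `#Ш_an(E) = q`, `ord₃ q = 0`. Then `BSDp W 3`. CONDITIONAL on 20395, 20385, 20386 (antecedents, by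
name) and the named facts; per datum; books nothing by itself. [cite: Miller2011LMS, §1 and Def. 1.1]
[cite: Jetchev2008, Cor. 1.5 and (1) (p. 812)] [cite: JetchevSkinnerWan2017, §7.4.1 (arXiv:1512.06894 p. 30)] -/
theorem bsdp_three_of_additiveSplitIMCInclusionAtThree_of_index_le_of_shaAnUnit
    (hGZK : rank_eq_analyticRank_of_analyticRank_le_one)
    (hIdx : padicValNat 3 (AddSubgroup.zmultiples P).index ≤
      padicValNat 3 W.tamagawaProduct + padicValNat 3 Dt.c.natAbs)
    {q : ℚ} (hq : shaAn W = (q : ℂ)) (hv : padicValRat 3 q = 0) : BSDp W 3 := by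
  have hnt := not_isOfFinAddOrder_of_rankOne_datum hGZ hmod W hr K Dt H ι P hK hHH hLd hP
  exact SchneiderFree.Exact.bsdp_of_upper_of_index_le_of_shaAnUnit hGZK W hr.le K hK 3 (by decide)
    (indexUpperBoundLeAt_of_additiveSplitIMCInclusionAtThree hKo hI hV hC W (W.conductorNorm ℤ) K Dt H ι P hO6
      hsurj hr rfl hK hHH hLd hP hnt)
    hIdx (hKo (W.conductorNorm ℤ) W K hK hHH ⟨Dt, H, ι, hP⟩ hnt).2 hq hv

include hGZ hKo hmod hI hV hC hO6 hsurj hr hK hHH hLd hP in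
/-- **`BSD₃` of the rank-ZERO wild twist `E^{d_K}` (any globally minimal model `Wd`) on the JET-PRODUCT shape,
from UTD's inclusion crux for the rank-ONE partner** + the index certificate + `#Ш_an(Wd)` a `3`-adic unit.
CONDITIONAL; per datum. [cite: Miller2011LMS, Def. 1.1] [cite: Jetchev2008, Cor. 1.5 and (1) (p. 812)]
[cite: JetchevSkinnerWan2017, §7.4.1 (arXiv:1512.06894 p. 30)] -/
theorem partner_bsdp_three_of_additiveSplitIMCInclusionAtThree_of_index_le_of_shaAnUnit
    (hGZK : rank_eq_analyticRank_of_analyticRank_le_one)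
    (Wd : WeierstrassCurve ℚ) [Wd.IsElliptic] [Wd.IsGloballyMinimal]
    (hCd : ∃ C : VariableChange ℚ, C • W.quadraticTwist (NumberField.discr K : ℚ) = Wd)
    (hIdx : padicValNat 3 (AddSubgroup.zmultiples P).index ≤
      padicValNat 3 W.tamagawaProduct + padicValNat 3 Dt.c.natAbs)
    {qd : ℚ} (hqd : shaAn Wd = (qd : ℂ)) (hvd : padicValRat 3 qd = 0) : BSDp Wd 3 := by
  have hnt := not_isOfFinAddOrder_of_rankOne_datum hGZ hmod W hr K Dt H ι P hK hHH hLd hP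
  exact SchneiderFree.Exact.partner_bsdp_of_upper_of_index_le_of_shaAnUnit hGZK W hr.le K hK 3 (by decide) Wd
    hLd hCd (hKo (W.conductorNorm ℤ) W K hK hHH ⟨Dt, H, ι, hP⟩ hnt).2
    (indexUpperBoundLeAt_of_additiveSplitIMCInclusionAtThree hKo hI hV hC W (W.conductorNorm ℤ) K Dt H ι P hO6
      hsurj hr rfl hK hHH hLd hP hnt)
    hIdx hqd hvd

include hGZ hKo hmod hI hV hC hO6 hsurj hr hK hHH hLd hP in
/-- **`BSD₃(E)` on the TAM3FREE / INDEX-EXCESS / SHA3-AN shapes from UTD's inclusion crux + certificates**: index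
excess `e` (`ord₃ [E(K):ℤP] ≤ ord₃ ∏c + v₃(c) + e`), `3`-descent lower certificates `a ≤ ord₃ #Ш(E)`,
`b ≤ ord₃ #Ш(Wd)` with `a + b = 2e` (`Wd` a `ℚ`-model of `E^{d_K}`), `#Ш_an(E) = q` with `ord₃ q = a`. Then
`BSDp W 3`. NO Eisenstein/lower-socket input, NO leaf. CONDITIONAL; per datum. [cite: Miller2011LMS, Def. 1.1]
[cite: Jetchev2008, Cor. 1.5 and (1) (p. 812)] [cite: DokchitserDokchitserAnnals2010, Lemma 4.14] -/
theorem bsdp_three_of_additiveSplitIMCInclusionAtThree_of_excess_certificates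
    (hGZK : rank_eq_analyticRank_of_analyticRank_le_one)
    (Wd : WeierstrassCurve ℚ) [Wd.IsElliptic]
    (hCd : ∃ C : VariableChange ℚ, C • W.quadraticTwist (NumberField.discr K : ℚ) = Wd)
    {e a b : ℕ} (hIdx : padicValNat 3 (AddSubgroup.zmultiples P).index ≤
      padicValNat 3 W.tamagawaProduct + padicValNat 3 Dt.c.natAbs + e)
    (ha : a ≤ padicValNat 3 W.shaOrder) (hb : b ≤ padicValNat 3 Wd.shaOrder) (hab : a + b = 2 * e)
    {q : ℚ} (hq : shaAn W = (q : ℂ)) (hv : padicValRat 3 q = a) : BSDp W 3 := by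
  have hnt := not_isOfFinAddOrder_of_rankOne_datum hGZ hmod W hr K Dt H ι P hK hHH hLd hP
  exact SchneiderFree.Exact.bsdp_of_upper_of_excess_certificates hGZK W hr.le K hK 3 (by decide) Wd hLd hCd
    (hKo (W.conductorNorm ℤ) W K hK hHH ⟨Dt, H, ι, hP⟩ hnt).2
    (indexUpperBoundLeAt_of_additiveSplitIMCInclusionAtThree hKo hI hV hC W (W.conductorNorm ℤ) K Dt H ι P hO6
      hsurj hr rfl hK hHH hLd hP hnt)
    hIdx ha hb hab hq hv

include hGZ hKo hmod hI hV hC hO6 hsurj hr hK hHH hLd hP in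
/-- **`BSD₃(E^{d_K})` (rank-ZERO wild twist, globally minimal model `Wd`) on the excess shapes from UTD's
inclusion crux + certificates**, the analytic certificate on the twist's side (`#Ш_an(Wd) = qd`, `ord₃ qd = b`).
CONDITIONAL; per datum. [cite: Miller2011LMS, Def. 1.1] [cite: Jetchev2008, Cor. 1.5 and (1) (p. 812)]
[cite: DokchitserDokchitserAnnals2010, Lemma 4.14] -/
theorem partner_bsdp_three_of_additiveSplitIMCInclusionAtThree_of_excess_certificates
    (hGZK : rank_eq_analyticRank_of_analyticRank_le_one)
    (Wd : WeierstrassCurve ℚ) [Wd.IsElliptic] [Wd.IsGloballyMinimal]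
    (hCd : ∃ C : VariableChange ℚ, C • W.quadraticTwist (NumberField.discr K : ℚ) = Wd)
    {e a b : ℕ} (hIdx : padicValNat 3 (AddSubgroup.zmultiples P).index ≤
      padicValNat 3 W.tamagawaProduct + padicValNat 3 Dt.c.natAbs + e)
    (ha : a ≤ padicValNat 3 W.shaOrder) (hb : b ≤ padicValNat 3 Wd.shaOrder) (hab : a + b = 2 * e)
    {qd : ℚ} (hqd : shaAn Wd = (qd : ℂ)) (hvd : padicValRat 3 qd = b) : BSDp Wd 3 := by
  have hnt := not_isOfFinAddOrder_of_rankOne_datum hGZ hmod W hr K Dt H ι P hK hHH hLd hP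
  exact SchneiderFree.Exact.partner_bsdp_of_upper_of_excess_certificates hGZK W hr.le K hK 3 (by decide) Wd hLd
    hCd (hKo (W.conductorNorm ℤ) W K hK hHH ⟨Dt, H, ι, hP⟩ hnt).2
    (indexUpperBoundLeAt_of_additiveSplitIMCInclusionAtThree hKo hI hV hC W (W.conductorNorm ℤ) K Dt H ι P hO6
      hsurj hr rfl hK hHH hLd hP hnt)
    hIdx ha hb hab hqd hvd

end ByName

/-! ### §2 Any odd additive `p`, ♭-receptacle: the displayed ♭-inclusion + Hsieh + LZZ + control + certificates -/

section Flat

open UniversalToricDescentWaldspurgerFlat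

variable {p : ℕ} [Fact p.Prime] {W : WeierstrassCurve ℚ} [W.IsElliptic] [W.IsGloballyMinimal]
  {N : ℕ} [NeZero N] {K : Type} [Field K] [NumberField K]

/-- **`BSD_p(E)` at ANY odd additive prime from the ♭-inclusion `(Q) ⊆ Ch_Λ(X_(∅,0) at 𝔭′)·𝓞_{ℂ_p}⟦T⟧` at one
Heegner datum + exact control + the index certificate + `#Ш_an(E)` a `p`-adic unit.** Data: `W` globally minimal,
additive at `p`, `r_an(E) ≤ 1`; `K` imaginary quadratic Heegner for `N = N(E)` with `d_K < −4`; `P` the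
non-torsion Heegner point of `(Dt, H, ι)`; Kolyvagin for the datum; the ♭-inclusion at every anticyclotomic
frame of this `K` and control at every degree-one `𝔭` (displayed, kmc g20's shapes); Hsieh 2014 Thm A and LZZ
2018 (named); certificates `ord_p [E(K):ℤP] ≤ ord_p ∏_ℓ c_ℓ(E) + v_p(c)` and `#Ш_an(E) = q`, `ord_p q = 0`.
Then `BSDp W p` (kmc g20's `indexUpperBoundLeAt_of_flatInclGe_of_control` + §1 of
`RankLeOneBSDpOfUpperSocketCertificate`). No route item, no `R₀`, no leaf. CONDITIONAL; per datum.
[cite: JetchevSkinnerWan2017, §7.4.1 (arXiv:1512.06894 p. 30)] [cite: Hsieh2014, Thm. A p. 712 (Doc. Math. 19)]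
[cite: LiuZhangZhang2018, Thm 1.5.1 and Thm 1.5.3 (Duke Math. J. 167 pp. 748–749)] [cite: Miller2011LMS, Def. 1.1] -/
theorem bsdp_of_flatInclGe_of_index_le_of_shaAnUnit (hp2 : p ≠ 2)
    (hA : Hsieh2014.thmA_exists_isHsiehLFunction_unrPeriod_anyLevel)
    (hL : LiuZhangZhang2018.thm151_thm153_modularCurve_heegnerVector_additive)
    (hGZK : rank_eq_analyticRank_of_analyticRank_le_one) (hr : W.analyticRank ≤ 1)
    (Dt : ModularParametrizationData W N) (H : HeegnerDatum N (NumberField.discr K)) (ι : K →+* ℂ)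
    (P : (W.baseChange K).toAffine.Point) (haddv : Addv W p) (hN : W.conductorNorm ℤ = N) (hK : IsImaginaryQuadratic K)
    (hHN : SatisfiesHeegnerHypothesis N K) (hd4 : NumberField.discr K < -4)
    (hP : WeierstrassCurve.Affine.Point.map ι.toRatAlgHom P = heegnerPointComplex Dt H) (hnt : ¬ IsOfFinAddOrder P)
    (hKo : Literature.NumberTheory.EllipticCurves.kolyvagin N W K)
    (hIncl : ∀ (κ : ZpExtension K p), κ.IsAnticyclotomic → ∀ (γ : Field.absoluteGaloisGroup K) [Fact (κ.IsTopGenerator γ)]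
        (𝔭 : HeightOneSpectrum (𝓞 K)), ((p : ℕ) : 𝓞 K) ∈ 𝔭.asIdeal → 𝔭.asIdeal.ramificationIdx (𝓞 ℚ) = 1 →
        𝔭.asIdeal.inertiaDeg (𝓞 ℚ) = 1 → ∀ (𝔭' : HeightOneSpectrum (𝓞 K)), ((p : ℕ) : 𝓞 K) ∈ 𝔭'.asIdeal → 𝔭' ≠ 𝔭 →
        ∀ (ι' : PadicAlgCl p ≃+* ℂ), SchneiderFree.BranchInducesPrime p ι' 𝔭 →
        ∀ (ΩK : ℂ) (Ωp : ℂ_[p]) (Q : PowerSeries (PadicComplexInt p)), ΩK ≠ 0 → Ωp ≠ 0 →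
          R1.IsBDPLFunctionInt p ι' 𝔭 κ γ Dt.f ΩK Ωp Q →
          Ideal.span {Q} ≤ (XAc.charIdeal (W.baseChange K) p κ 𝔭' ∅ γ).map (PowerSeries.map (R1.toCpInt p)))
    (hCtl : ∀ (κ : ZpExtension K p), κ.IsAnticyclotomic → ∀ (γ : Field.absoluteGaloisGroup K) [Fact (κ.IsTopGenerator γ)]
        (𝔭 : HeightOneSpectrum (𝓞 K)) (h𝔭 : ((p : ℕ) : 𝓞 K) ∈ 𝔭.asIdeal) (he : 𝔭.asIdeal.ramificationIdx (𝓞 ℚ) = 1)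
        (hf : 𝔭.asIdeal.inertiaDeg (𝓞 ℚ) = 1), SchneiderFree.AdditiveControlOnTreeAt p κ 𝔭 γ (embAt K p 𝔭 h𝔭 he hf) P)
    (hIdx : padicValNat p (AddSubgroup.zmultiples P).index ≤ padicValNat p W.tamagawaProduct + padicValNat p Dt.c.natAbs)
    {q : ℚ} (hq : shaAn W = (q : ℂ)) (hv : padicValRat p q = 0) : BSDp W p :=
  SchneiderFree.Exact.bsdp_of_upper_of_index_le_of_shaAnUnit hGZK W hr K hK p hp2
    (indexUpperBoundLeAt_of_flatInclGe_of_control hp2 hA hL Dt H ι P haddv hN hK hHN hd4 hP hnt hKo hIncl hCtl)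
    hIdx (hKo hK hHN ⟨Dt, H, ι, hP⟩ hnt).2 hq hv

/-- **`BSD_p(E^{d_K})` (rank-ZERO twist, globally minimal model `Wd`) at ANY odd additive `p` from the
♭-inclusion for the rank-`≤ 1` partner + control + excess certificates** (index excess `e`, lower certificates
`a + b = 2e`, `#Ш_an(Wd) = qd` with `ord_p qd = b`; `L(E^{d_K},1) ≠ 0`). Same displayed inputs as
`bsdp_of_flatInclGe_of_index_le_of_shaAnUnit`. CONDITIONAL; per datum. [cite: Miller2011LMS, Def. 1.1]
[cite: JetchevSkinnerWan2017, §7.4.1 (arXiv:1512.06894 p. 30)] [cite: Hsieh2014, Thm. A p. 712 (Doc. Math. 19)]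
[cite: LiuZhangZhang2018, Thm 1.5.1 and Thm 1.5.3 (Duke Math. J. 167 pp. 748–749)] -/
theorem partner_bsdp_of_flatInclGe_of_excess_certificates (hp2 : p ≠ 2)
    (hA : Hsieh2014.thmA_exists_isHsiehLFunction_unrPeriod_anyLevel)
    (hL : LiuZhangZhang2018.thm151_thm153_modularCurve_heegnerVector_additive)
    (hGZK : rank_eq_analyticRank_of_analyticRank_le_one) (hr : W.analyticRank ≤ 1)
    (Dt : ModularParametrizationData W N) (H : HeegnerDatum N (NumberField.discr K)) (ι : K →+* ℂ)
    (P : (W.baseChange K).toAffine.Point) (haddv : Addv W p) (hN : W.conductorNorm ℤ = N) (hK : IsImaginaryQuadratic K)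
    (hHN : SatisfiesHeegnerHypothesis N K) (hd4 : NumberField.discr K < -4)
    (hP : WeierstrassCurve.Affine.Point.map ι.toRatAlgHom P = heegnerPointComplex Dt H) (hnt : ¬ IsOfFinAddOrder P)
    (hKo : Literature.NumberTheory.EllipticCurves.kolyvagin N W K)
    (hIncl : ∀ (κ : ZpExtension K p), κ.IsAnticyclotomic → ∀ (γ : Field.absoluteGaloisGroup K) [Fact (κ.IsTopGenerator γ)]
        (𝔭 : HeightOneSpectrum (𝓞 K)), ((p : ℕ) : 𝓞 K) ∈ 𝔭.asIdeal → 𝔭.asIdeal.ramificationIdx (𝓞 ℚ) = 1 →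
        𝔭.asIdeal.inertiaDeg (𝓞 ℚ) = 1 → ∀ (𝔭' : HeightOneSpectrum (𝓞 K)), ((p : ℕ) : 𝓞 K) ∈ 𝔭'.asIdeal → 𝔭' ≠ 𝔭 →
        ∀ (ι' : PadicAlgCl p ≃+* ℂ), SchneiderFree.BranchInducesPrime p ι' 𝔭 →
        ∀ (ΩK : ℂ) (Ωp : ℂ_[p]) (Q : PowerSeries (PadicComplexInt p)), ΩK ≠ 0 → Ωp ≠ 0 →
          R1.IsBDPLFunctionInt p ι' 𝔭 κ γ Dt.f ΩK Ωp Q →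
          Ideal.span {Q} ≤ (XAc.charIdeal (W.baseChange K) p κ 𝔭' ∅ γ).map (PowerSeries.map (R1.toCpInt p)))
    (hCtl : ∀ (κ : ZpExtension K p), κ.IsAnticyclotomic → ∀ (γ : Field.absoluteGaloisGroup K) [Fact (κ.IsTopGenerator γ)]
        (𝔭 : HeightOneSpectrum (𝓞 K)) (h𝔭 : ((p : ℕ) : 𝓞 K) ∈ 𝔭.asIdeal) (he : 𝔭.asIdeal.ramificationIdx (𝓞 ℚ) = 1)
        (hf : 𝔭.asIdeal.inertiaDeg (𝓞 ℚ) = 1), SchneiderFree.AdditiveControlOnTreeAt p κ 𝔭 γ (embAt K p 𝔭 h𝔭 he hf) P)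
    (Wd : WeierstrassCurve ℚ) [Wd.IsElliptic] [Wd.IsGloballyMinimal]
    (hLd : (W.quadraticTwist (NumberField.discr K : ℚ)).entireLFunction 1 ≠ 0)
    (hCd : ∃ C : VariableChange ℚ, C • W.quadraticTwist (NumberField.discr K : ℚ) = Wd)
    {e a b : ℕ} (hIdx : padicValNat p (AddSubgroup.zmultiples P).index ≤
      padicValNat p W.tamagawaProduct + padicValNat p Dt.c.natAbs + e)
    (ha : a ≤ padicValNat p W.shaOrder) (hb : b ≤ padicValNat p Wd.shaOrder) (hab : a + b = 2 * e)
    {qd : ℚ} (hqd : shaAn Wd = (qd : ℂ)) (hvd : padicValRat p qd = b) : BSDp Wd p :=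
  SchneiderFree.Exact.partner_bsdp_of_upper_of_excess_certificates hGZK W hr K hK p hp2 Wd hLd hCd
    (hKo hK hHN ⟨Dt, H, ι, hP⟩ hnt).2
    (indexUpperBoundLeAt_of_flatInclGe_of_control hp2 hA hL Dt H ι P haddv hN hK hHN hd4 hP hnt hKo hIncl hCtl)
    hIdx ha hb hab hqd hvd

end Flat

end Summit.BirchSwinnertonDyer.BirchSwinnertonDyer.Theorems.WildThreeInclusionKernel

end
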